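import Summits.QuantumFields.YangMills.Theorems.UnitScaleTiltFluctuationComparisonRegPrPrintChiTransfer
import Literature.MathematicalPhysics.QuantumFieldTheory.Balaban1983to89.T3PrintedMinimiserExistence
import Literature.MathematicalPhysics.QuantumFieldTheory.Balaban1983to89.T3LowerAlongMinimisersSplit
import Literature.MathematicalPhysics.QuantumFieldTheory.Balaban1983to89.T3AvgDivergenceSplit
import Literature.MathematicalPhysics.QuantumFieldTheory.Balaban1983to89.T3InteriorExcision
import HarnessLib

/-!
# REGISTRY STUB 1 «EXW∘» FROM REGISTRY STUB 2 «GAP♯∘» AND THE EX LETTER — `WindowExactness` ⟸ {`UniformFibreGapOrbit`, [Balaban1985Variational] Thm 1 (8)}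
# (crux `FluctuationComparisonRegPrIntL`, stmt-QuantumFields-20520; registry of record v11.4 `Cruxes/FluctuationComparisonRegPrIntL/Lines/semiclassical_s2beta.lean` 3732b7df)

Cell `ym3-torus` (YM ladder rung R3 = continuum `SU(2)` Yang–Mills on the three-torus — a RUNG, NOT d = 4, NOT infinite volume, NOT a mass gap, NOT Clay).
Width seat `ym-ust-20520-w4` (gen 19); `--supports stmt-QuantumFields-20520 --as helper`, count-neutral, definition-free, default heartbeats.

WHAT.  The registered organ row EXW∘ `WindowExactness` (v11.4 text, by-text docking — Cruxes workfiles cannot be imported) has two clauses at every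
interior-window datum `V` (`PlaqSmall (θBal F.L γ (cw·b₀) p₀ J) V`) of every run `K ≥ J`:
* (1) `minActionRegPr F J K hJK ε₀ V ≤ wilsonAction4 U` for EVERY good-history fine field `U` over `V` (`U ∈ fibre … V`, `U ∈ histGood(θBal b₀) K J`);
* (2) a print-regular minimiser `U₀ ∈ regFibrePr F J K hJK ε₀ V`, `wilsonAction4 U₀ = minActionRegPr …`, whose WHOLE HISTORY IS GOOD, `U₀ ∈ histGood(θBal b₀) K J`.

§1–§2: **(2) ⟸ [Balaban1985Variational] THM 1 (8) ALONE** (the tree's global reading `Thm1GlobalMinAt`, the first conjunct of the EX letter `hT8` of the 19936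
registry ∕ of the persistence leaf ✓p769530): on the deep interior (`B₃·cw ≤ 1`, `ε₀ ≤ a₀`, `γ ≤ γ₁(L, cw, b₀, p₀, ε₀, a₁, B₃)`) Thm 1 at radius `ε₁ := θBal(cw·b₀)(J)`
puts the minimiser over print's space (6) into (8) — finest plaquettes `< B₃·cw·θBal(b₀)(J)·L^{−2(K−J)} ≤ θBal(b₀)(J)·L^{−2(K−J)}`, print's `χ_k` — and
[Balaban1985Averaging] Prop. 2 (53) (✓`PrintChi.chiGood_of_printChi_sharp`, over ✓`plaqSmall_iter_blockAvg_eml_level`) carries every block average of it into its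
window: this is seat `ym-cruxidea-19201-2`∕`InteriorExcision`'s (E1) `interior_chiGood_of_thm1GlobalMinAt` (✓, theses-cone module — re-derived here VERBATIM in proof so
that this file stays outside the theses cone), plus the datum's own level `j = K − J` read off `hV` and the corner `J = K` (witness `V` itself: ✓`fibre_self`,
✓`T3AvgDivergenceSplit.regPr_of_plaqSmall` once `4·θBal(cw b₀)(K) < ε₀`).
§3: **(1) ⟸ GAP♯∘ ∧ (2)**: GAP♯∘'s excess-action inequality is quantified over `U₀ ∈ argminHist V` — (2)'s `U₀` is one — and its left side
`μ·L^{−2(K−J)}·⨅_w Σ_ℓ dist1(…)² ≥ 0` (`Real.iInf_nonneg`), so `0 ≤ wilsonAction4 U − minActionRegPr`.  Thresholds merge by `min`∕`max`; block sizes that are not odd `> 1`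
carry no `T3Family` and are served vacuously.

* §1 `two_le_L_mul_sqrt`, `chiGood_interior_of_thm1GlobalMinAt` ((E1) re-derived, margin `μ_L = 1 − 2∕(L√L)`), `histGood_of_chiGood_witness` (the datum level added),
  `exists_regMin_histGood_self` (the corner `J = K`).
* §2 ★★ `windowExactnessExists_of_thm1` — EXW∘'s prefix and window VERBATIM with CLAUSE (2) ONLY, from the Thm-1 letter `∀ L, Odd L → 1 < L → ∃ a₀ a₁ B₃ > 0, Thm1GlobalMinAt L a₀ a₁ B₃`.
* §3 ★★★ `windowExactness_of_gapOrbit_thm1 (hGap) (hT) : ⟨EXW∘ TEXT VERBATIM⟩` — `hGap` = the v11.4 text of `UniformFibreGapOrbit` with the two RG-K substitutions of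
  ✓`…S2BetaResidualGaugeOrbit` (`argminHist` ↦ its set-builder body, `ResidualGauge F hJK` ↦ `{w : Site (F.P K) 0 → SU(2) | ∀ U, descendTo … (gaugeAct w U) = descendTo … U}`),
  so both dock in `Lines/semiclassical_s2beta.lean` by `exact`; ★★★ `windowExactness_of_gapOrbit_thm1In8 (hGap) (hT8)` — the same with the EX letter `hT8` VERBATIM
  (its `MinimisersIn8At` conjunct unused).

NET (registry granularity, CREDIT NOTHING): of the five registered ∘-stubs {EXW∘, GAP♯∘, DET-REP-B‴∘, H4ᶜ∘, LFR♯ᶜ∘}, **EXW∘ is not an independent leaf: EXW∘ ⟸ {GAP♯∘, EX-letter}**,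
and its existence half (2) ⟸ EX-letter alone.  HONEST: a door over landed theorems; GAP♯∘, the EX letter ([Balaban1985Variational] Thm 1 + Prop 7∕8 for the (0.4)
averaging `ℰp`), EXW∘ itself, S2β, `FluctuationComparisonRegPrIntL` (20520), EX (19200) are NOT proved here; no summit is proved by a helper; rung R3 = SU(2) YM₃ on T³ —
NOT d = 4, NOT infinite volume, NOT a mass gap, NOT Clay.  Sorry-free, axioms standard.

References: T. Bałaban, CMP **102** (1985) 277–309 [Balaban1985Variational] (Thm 1 (8) p.279, Prop 7 p.299, Prop 8 p.304, (142) p.299); T. Bałaban, CMP **98** (1985) 17–51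
[Balaban1985Averaging] (Prop. 2 (52)–(54) p.26); T. Bałaban, CMP **102** (1985) 255–275 [Balaban1985UV3] ((7) p.257, (41) p.266, (47) p.267).
-/

set_option autoImplicit false

noncomputable section

namespace Summit.QuantumFields.YangMills.Theorems.FluctuationComparisonRegPrIntLWindowExactnessOfGapOrbitThm1

open Literature.MathematicalPhysics.QuantumFieldTheory.Balaban1983to89
open Literature.MathematicalPhysics.QuantumFieldTheory.Balaban1983to89.T3ContinuumYM3Torus
open Literature.MathematicalPhysics.QuantumFieldTheory.Balaban1983to89.T3UnitLawDensityEML (ℰp)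
open Literature.MathematicalPhysics.QuantumFieldTheory.Balaban1983to89.T3UnitScaleTilt
open Literature.MathematicalPhysics.QuantumFieldTheory.Balaban1983to89.T3TiltDescent
open Literature.MathematicalPhysics.QuantumFieldTheory.Balaban1983to89.T3CruxEstimates (plaqSmall_fieldShift)
open Literature.MathematicalPhysics.QuantumFieldTheory.Balaban1983to89.T3ConstrainedMinimiser (fibre)
open Literature.MathematicalPhysics.QuantumFieldTheory.Balaban1983to89.T3DescentFibreTower
open Literature.MathematicalPhysics.QuantumFieldTheory.Balaban1983to89.T3RegularMinimiser
open Literature.MathematicalPhysics.QuantumFieldTheory.Balaban1983to89.T3PrintedRegularMinimiser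
open Literature.MathematicalPhysics.QuantumFieldTheory.Balaban1983to89.T3PrintedMinimiserExistence
open Literature.MathematicalPhysics.QuantumFieldTheory.Balaban1983to89.T3LowerAlongMinimisersSplit (MinimisersIn8At)
open Literature.MathematicalPhysics.QuantumFieldTheory.Balaban1983to89.T3MinimiserStabilityReduction (θBal_pos)
open Literature.MathematicalPhysics.QuantumFieldTheory.Balaban1983to89.T3ThresholdSmallness (exists_forall_θBal_le)
open Literature.MathematicalPhysics.QuantumFieldTheory.Balaban1983to89.T3InteriorExcision (θBal_mul θBal_mul_le histGood_mono_profile)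
open Literature.MathematicalPhysics.QuantumFieldTheory.Balaban1983to89.T3AvgDivergenceSplit (regPr_of_plaqSmall)
open Literature.MathematicalPhysics.QuantumFieldTheory.Balaban1983to89.ExpMeanLog (deltaSU deltaSU_pos)
open Literature.MathematicalPhysics.QuantumFieldTheory.Balaban1983to89.Missing
open Literature.MathematicalPhysics.QuantumFieldTheory.Balaban1983to89.T4Continuum
open Summit.QuantumFields.YangMills.Theorems.PrintChi

/-! ## §1 The interior datum's regular minimiser has a good history ([7] Thm 1 (8) + [B] Prop. 2 (53)); the corner `J = K` -/

section Witness

variable {F : T3Family} {γ b₀ p₀ ε₀ cw : ℝ}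

/-- `2 ≤ L·√L` for the family's block sizes (`L` odd, `1 < L`, so `3 ≤ L` and `1 ≤ √L`). [cite: Balaban1985Averaging, Prop. 2 (53) p.26] -/
theorem two_le_L_mul_sqrt (F : T3Family) : (2 : ℝ) ≤ (F.L : ℝ) * Real.sqrt F.L := by
  have hL2 : (2 : ℝ) ≤ F.L := by exact_mod_cast (show 2 ≤ F.L from F.hL.2)
  have hs : (1 : ℝ) ≤ Real.sqrt F.L := by
    rw [show (1 : ℝ) = Real.sqrt 1 by simp]
    exact Real.sqrt_le_sqrt (by linarith)
  nlinarith

/-- **(E1) RE-DERIVED — THE DEEP INTERIOR IS χ-GOOD, FROM [Balaban1985Variational] THM 1 (8)** (verbatim the statement and proof of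
`InteriorExcision.interior_chiGood_of_thm1GlobalMinAt`, a theses-cone module, kept out of this file's imports): if `B₃·c ≤ 1`, `ε₀ ≤ a₀`, then below a coupling threshold
depending on `L, b₀, p₀, ε₀, a₁, B₃, c` only, every datum `V` with `PlaqSmall (θBal(c·b₀) n) V` (`n < K`) is χ-good for run `K` with print's margin `μ_L = 1 − 2∕(L√L)`:
Thm 1 at radius `ε₁ := θBal(c·b₀)(n)` puts the minimiser over (6) into (8) (finest plaquettes `< θBal(b₀)(n)·L^{−2(K−n)}`, print's `χ_k`), and
✓`PrintChi.chiGood_of_printChi_sharp` ([Balaban1985Averaging] Prop. 2 (53)) carries its block averages into the windows. [cite: Balaban1985Variational, Thm 1 (8) p.279] -/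
theorem chiGood_interior_of_thm1GlobalMinAt {L : ℕ} (hL : 1 ≤ L) {a₀ a₁ B₃ c : ℝ} (hT : Thm1GlobalMinAt L a₀ a₁ B₃) (ha₁ : 0 < a₁)
    (hB₃ : 0 < B₃) (hb : 0 < b₀) (hp : 0 ≤ p₀) (hε₀ : 0 < ε₀) (hε₀a : ε₀ ≤ a₀) (hc0 : 0 < c) (hcB : B₃ * c ≤ 1) :
    ∃ γ₁ : ℝ, 0 < γ₁ ∧ γ₁ ≤ 1 ∧ ∀ (F : T3Family) (γ : ℝ), F.L = L → 0 < γ → γ ≤ γ₁ → ∀ {n K : ℕ} (hnK : n < K)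
      (V : GaugeField (F.P n) 0 (Matrix.specialUnitaryGroup (Fin 2) ℂ)),
      PlaqSmall (θBal F.L γ (c * b₀) p₀ n) V →
        ChiGood F γ b₀ p₀ ε₀ (1 - 2 / ((F.L : ℝ) * Real.sqrt F.L)) hnK.le V := by
  have hL0 : (0 : ℝ) < L := by exact_mod_cast (show 0 < L by omega)
  have hC₀ : (0 : ℝ) < 143 * ((((3 + 4 : ℕ) : ℝ)) ^ 2 / 4) ^ 2 := by positivity
  have h7L : (0 : ℝ) < (((3 + 4) * L : ℕ) : ℝ) ^ 2 := by
    have : 0 < (3 + 4) * L := by omega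
    positivity
  obtain ⟨γ₀, hγ₀, hsmall₀⟩ := exists_forall_θBal_le hL b₀ p₀
    (lt_min (div_pos (by norm_num : (0 : ℝ) < 1 / 3) hC₀) (div_pos deltaSU_pos h7L) :
      (0 : ℝ) < min (1 / 3 / (143 * ((((3 + 4 : ℕ) : ℝ)) ^ 2 / 4) ^ 2)) (deltaSU (Fin 2) / (((3 + 4) * L : ℕ) : ℝ) ^ 2))
  obtain ⟨γ_b, hγ_b, hsmall⟩ := exists_forall_θBal_le hL (c * b₀) p₀ (lt_min ha₁ (div_pos hε₀ hB₃))
  refine ⟨min (min γ₀ γ_b) 1, lt_min (lt_min hγ₀ hγ_b) one_pos, min_le_right _ _, fun F γ hF hγ hγle n K hnK V hV => ?_⟩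
  subst hF
  have hLs : 0 < (F.L : ℝ) * Real.sqrt F.L := by positivity
  have hγa : γ ≤ γ₀ := hγle.trans ((min_le_left _ _).trans (min_le_left _ _))
  have hγb : γ ≤ γ_b := hγle.trans ((min_le_left _ _).trans (min_le_right _ _))
  have hγ1 : γ ≤ 1 := hγle.trans (min_le_right _ _)
  have hcb : 0 < c * b₀ := mul_pos hc0 hb
  have hε₁ : 0 < θBal F.L γ (c * b₀) p₀ n := θBal_pos hL hγ hγ1 hcb p₀ n
  have hθ := hsmall γ hγ hγb n
  have hε₁a : θBal F.L γ (c * b₀) p₀ n ≤ a₁ := hθ.trans (min_le_left _ _)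
  have hlo : B₃ * θBal F.L γ (c * b₀) p₀ n ≤ ε₀ := by
    have h := hθ.trans (min_le_right _ _)
    rwa [le_div_iff₀ hB₃, mul_comm] at h
  obtain ⟨U, hU8, hmin⟩ := hT F rfl n K hnK _ ε₀ hε₁ hε₁a hlo hε₀a V hV
  have hU6 : U ∈ regFibrePr F n K hnK.le ε₀ V := regFibrePr_mono F hlo V hU8
  have hminEq := minActionRegPr_eq_of_isMinOn F hU6 hmin
  -- print's `χ_k` for the minimiser: finest plaquettes `< B₃·θBal(c b₀)(n)·η² ≤ θBal(b₀)(n)·η²`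
  have hχU : PlaqSmall (θBal F.L γ b₀ p₀ n * ((F.L : ℝ)⁻¹) ^ (2 * (K - n))) U := by
    have h8 : PlaqSmall (regThreshold F n K (B₃ * θBal F.L γ (c * b₀) p₀ n)) U := ((mem_regFibrePr_iff F).mp hU8).2.1
    refine fun p => (h8 p).trans_le ?_
    show B₃ * θBal F.L γ (c * b₀) p₀ n * ((F.L : ℝ)⁻¹) ^ (2 * (K - n)) ≤ θBal F.L γ b₀ p₀ n * ((F.L : ℝ)⁻¹) ^ (2 * (K - n))
    refine mul_le_mul_of_nonneg_right ?_ (pow_nonneg (inv_nonneg.mpr (Nat.cast_nonneg _)) _)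
    rw [θBal_mul, ← mul_assoc]
    exact mul_le_of_le_one_left (θBal_pos hL hγ hγ1 hb p₀ n).le hcB
  have hθc := hsmall₀ γ hγ hγa n
  refine chiGood_of_printChi_sharp hγ hγ1 hb hp hnK.le hU6 hminEq hχU ?_ ?_ (le_of_eq ?_)
  · have h1 : θBal F.L γ b₀ p₀ n ≤ 1 / 3 / (143 * ((((3 + 4 : ℕ) : ℝ)) ^ 2 / 4) ^ 2) := hθc.trans (min_le_left _ _)
    rwa [le_div_iff₀ hC₀, mul_comm] at h1
  · have h2 : θBal F.L γ b₀ p₀ n ≤ deltaSU (Fin 2) / (((3 + 4) * F.L : ℕ) : ℝ) ^ 2 := hθc.trans (min_le_right _ _)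
    rw [mul_div_assoc]
    linarith
  · field_simp
    ring

/-- **THE χ-WITNESS HAS A GOOD HISTORY IN EXW∘'s SENSE**: a χ-good witness `U` (regular minimiser over `V` with `U ∈ histGood((1−μ)·θBal) K (J+1)`, `0 ≤ μ`) over a
datum `V` in the sharp window `PlaqSmall (θBal b₀ J) V` lies in `histGood(θBal b₀) K J`: the levels strictly below the datum come from χ, the datum's own level
`j = K − J` is `D_{J,K}U = V` read through ✓`plaqSmall_fieldShift`. [cite: Balaban1985UV3, (7) p.257 and (47) p.267] -/
theorem histGood_of_chiGood_witness {μ : ℝ} (hμ : 0 ≤ μ) (hγ : 0 < γ) (hγ1 : γ ≤ 1) (hb : 0 < b₀) {J K : ℕ} (hJK : J ≤ K)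
    {V : GaugeField (F.P J) 0 (Matrix.specialUnitaryGroup (Fin 2) ℂ)} (hV : PlaqSmall (θBal F.L γ b₀ p₀ J) V)
    {U : GaugeField (F.P K) 0 (Matrix.specialUnitaryGroup (Fin 2) ℂ)} (hUf : U ∈ fibre F ℰp J K hJK V)
    (hUh : U ∈ histGood F ℰp (θShrunk F γ b₀ p₀ μ) K (J + 1)) :
    U ∈ histGood F ℰp (θBal F.L γ b₀ p₀) K J := by
  have hmono : U ∈ histGood F ℰp (θBal F.L γ b₀ p₀) K (J + 1) :=
    histGood_mono_profile F (fun i => θShrunk_le_θBal hμ hγ hγ1 hb i) K (J + 1) hUh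
  intro j hj
  by_cases hj' : j + (J + 1) ≤ K
  · exact hmono j hj'
  · -- the datum's own level: `j = K − J`, `iter j U` is `D_{J,K}U = V` up to the level identification
    have hjK : j = K - J := by omega
    subst hjK
    have hD : PlaqSmall (θBal F.L γ b₀ p₀ J) (descendTo F ℰp J K hJK U) := by
      rw [(mem_fibre_iff F ℰp).mp hUf]; exact hV
    have h := (plaqSmall_fieldShift F _ (θBal F.L γ b₀ p₀ J) _).mp hD
    rwa [show K - (K - J) = J by omega]

/-- **THE CORNER `J = K`** (no averaging between datum and run): below a coupling threshold with `4·θBal(cw·b₀)(K) < ε₀` at every `K`, an interior datum `V`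
(`PlaqSmall (θBal(cw b₀) K) V`, `cw ≤ 1`) is its own print-regular minimiser over the one-point fibre `{V}` (✓`fibre_self`; both clauses of [7] (2) by
✓`T3AvgDivergenceSplit.regPr_of_plaqSmall`), with the good (one-level) history. [cite: Balaban1985Variational, (2) and (6) p.278] -/
theorem exists_regMin_histGood_self (hγ : 0 < γ) (hγ1 : γ ≤ 1) (hb : 0 < b₀) (hcw0 : 0 < cw) (hcw1 : cw ≤ 1) (K : ℕ)
    (hθε : 4 * θBal F.L γ (cw * b₀) p₀ K < ε₀)
    {V : GaugeField (F.P K) 0 (Matrix.specialUnitaryGroup (Fin 2) ℂ)} (hV : PlaqSmall (θBal F.L γ (cw * b₀) p₀ K) V) :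
    ∃ U₀ ∈ regFibrePr F K K le_rfl ε₀ V, U₀ ∈ histGood F ℰp (θBal F.L γ b₀ p₀) K K ∧
      wilsonAction4 U₀ = minActionRegPr F K K le_rfl ε₀ V := by
  have hL : 1 ≤ F.L := F.hL.2.le
  have hθpos : 0 < θBal F.L γ (cw * b₀) p₀ K := θBal_pos hL hγ hγ1 (mul_pos hcw0 hb) p₀ K
  -- both clauses of (2) at `K − K = 0`: thresholds `ε₀·L⁰ = ε₀`
  have hreg : RegPr F K K ε₀ V := by
    refine regPr_of_plaqSmall F hV ?_ ?_
    · show θBal F.L γ (cw * b₀) p₀ K ≤ ε₀ * ((F.L : ℝ)⁻¹) ^ (2 * (K - K))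
      rw [Nat.sub_self, mul_zero, pow_zero, mul_one]
      linarith
    · rw [Nat.sub_self, mul_zero, pow_zero, mul_one]
      exact hθε
  have hmem : V ∈ regFibrePr F K K le_rfl ε₀ V := (mem_regFibrePr_iff F).mpr ⟨by rw [fibre_self]; rfl, hreg⟩
  refine ⟨V, hmem, ?_, ?_⟩
  · -- the one-level history: only `j = 0`, i.e. `V` itself, in the sharp window
    intro j hj
    have hj0 : j = 0 := by omega
    subst hj0
    rw [Nat.sub_zero]
    exact fun p => (hV p).trans_le (θBal_mul_le hL hγ hγ1 hb hcw1 p₀ K)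
  · refine minActionRegPr_eq_of_isMinOn F hmem fun W hW => ?_
    have hWV : W = V := by
      have h := ((mem_regFibrePr_iff F).mp hW).1
      rwa [fibre_self] at h
    rw [hWV]
    exact (le_refl _ : wilsonAction4 V ≤ wilsonAction4 V)

end Witness

/-! ## §2 EXW∘'s EXISTENCE CLAUSE (2) from the Thm-1 letter alone -/

section Existence

/-- ★★ **EXW∘ WITH CLAUSE (2) ONLY ⟸ [Balaban1985Variational] THM 1 (8) AT EVERY ODD BLOCK SIZE** — EXW∘'s quantifier prefix and interior window VERBATIM
(`c₀ := min 1 B₃⁻¹`, `ε₁ := a₀`, `γ₁(L, cw, b₀, p₀, ε₀)` := the smaller of (E1)'s threshold and the corner's `4θBal(cw b₀) < ε₀` threshold); at every run `K ≥ J` and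
interior datum `V` there is a print-regular minimiser over `V` whose whole history is good.  GAP-free; the letter is the first conjunct of the EX row `hT8`.
[cite: Balaban1985Variational, Thm 1 (8) p.279 and Prop 7 p.299] -/
theorem windowExactnessExists_of_thm1
    (hT : ∀ L : ℕ, Odd L → 1 < L → ∃ a₀ a₁ B₃ : ℝ, 0 < a₀ ∧ 0 < a₁ ∧ 0 < B₃ ∧ Thm1GlobalMinAt L a₀ a₁ B₃) :
    ∀ (L : ℕ), ∃ c₀ : ℝ, 0 < c₀ ∧ c₀ ≤ 1 ∧ ∀ (cw : ℝ), 0 < cw → cw ≤ c₀ → ∃ pS : ℝ, ∀ (b₀ p₀ : ℝ), 0 < b₀ → pS ≤ p₀ → 0 < p₀ →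
      ∃ ε₁ : ℝ, 0 < ε₁ ∧ ∀ (ε₀ : ℝ), 0 < ε₀ → ε₀ ≤ ε₁ →
      ∃ γ₁ : ℝ, 0 < γ₁ ∧ ∀ (F : T3Family) (γ : ℝ), F.L = L → 0 < γ → γ ≤ γ₁ →
        ∀ (J K : ℕ) (hJK : J ≤ K) (V : GaugeField (F.P J) 0 (Matrix.specialUnitaryGroup (Fin 2) ℂ)), PlaqSmall (θBal F.L γ (cw * b₀) p₀ J) V →
          ∃ U₀ ∈ regFibrePr F J K hJK ε₀ V, U₀ ∈ histGood F ℰp (θBal F.L γ b₀ p₀) K J ∧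
            wilsonAction4 U₀ = minActionRegPr F J K hJK ε₀ V := by
  intro L
  by_cases hLodd : Odd L ∧ 1 < L
  swap
  · -- no family has this block size: everything is vacuous
    refine ⟨1, one_pos, le_rfl, fun cw _ _ => ⟨0, fun b₀ p₀ _ _ _ => ⟨1, one_pos, fun ε₀ _ _ => ⟨1, one_pos, ?_⟩⟩⟩⟩
    intro F γ hFL
    exact absurd (hFL ▸ F.hL) hLodd
  obtain ⟨a₀, a₁, B₃, ha₀, ha₁, hB₃, hT1⟩ := hT L hLodd.1 hLodd.2
  have hL : 1 ≤ L := hLodd.2.le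
  refine ⟨min 1 B₃⁻¹, lt_min one_pos (inv_pos.mpr hB₃), min_le_left _ _, fun cw hcw0 hcwle => ?_⟩
  have hcw1 : cw ≤ 1 := hcwle.trans (min_le_left _ _)
  have hcB : B₃ * cw ≤ 1 := by
    have h := mul_le_mul_of_nonneg_left (hcwle.trans (min_le_right _ _)) hB₃.le
    rwa [mul_inv_cancel₀ hB₃.ne'] at h
  refine ⟨0, fun b₀ p₀ hb _ hp => ⟨a₀, ha₀, fun ε₀ hε₀ hε₀a => ?_⟩⟩
  obtain ⟨γE, hγE, hγE1, HE⟩ :=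
    chiGood_interior_of_thm1GlobalMinAt (b₀ := b₀) (p₀ := p₀) hL hT1 ha₁ hB₃ hb hp.le hε₀ hε₀a hcw0 hcB
  obtain ⟨γc, hγc, Hc⟩ := exists_forall_θBal_le hL (cw * b₀) p₀ (show (0 : ℝ) < ε₀ / 8 by positivity)
  refine ⟨min γE γc, lt_min hγE hγc, fun F γ hFL hγ hγle J K hJK V hV => ?_⟩
  have hγE' : γ ≤ γE := hγle.trans (min_le_left _ _)
  have hγ1 : γ ≤ 1 := hγE'.trans hγE1
  rcases Nat.eq_or_lt_of_le hJK with hEq | hlt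
  · -- the corner `J = K`
    subst hEq
    have hθε : 4 * θBal F.L γ (cw * b₀) p₀ J < ε₀ := by
      have h := Hc γ hγ (hγle.trans (min_le_right _ _)) J
      rw [hFL]
      linarith
    exact exists_regMin_histGood_self hγ hγ1 hb hcw0 hcw1 J hθε hV
  · -- `J < K`: (E1) + the datum level
    obtain ⟨U, hUreg, hUmin, hUhist⟩ := HE F γ hFL hγ hγE' hlt V hV
    have hμ : (0 : ℝ) ≤ 1 - 2 / ((F.L : ℝ) * Real.sqrt F.L) := by
      have h2 := two_le_L_mul_sqrt F
      have hpos : (0 : ℝ) < (F.L : ℝ) * Real.sqrt F.L := by linarith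
      rw [sub_nonneg, div_le_one hpos]
      exact h2
    have hVb : PlaqSmall (θBal F.L γ b₀ p₀ J) V :=
      fun p => (hV p).trans_le (θBal_mul_le F.hL.2.le hγ hγ1 hb hcw1 p₀ J)
    exact ⟨U, hUreg, histGood_of_chiGood_witness hμ hγ hγ1 hb hJK hVb ((mem_regFibrePr_iff F).mp hUreg).1 hUhist, hUmin⟩

end Existence

/-! ## §3 EXW∘ VERBATIM from GAP♯∘ and the Thm-1 letter -/

section Door

/-- ★★★ **REGISTRY STUB 1 EXW∘ ⟸ REGISTRY STUB 2 GAP♯∘ + THE THM-1 LETTER.**  Hypotheses: `hGap` = the v11.4 text of `UniformFibreGapOrbit` (with `argminHist`∕`ResidualGauge`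
replaced by their bodies, the RG-K substitutions), `hT` = [Balaban1985Variational] Thm 1 (8) at every odd block size; conclusion: the v11.4 text of `WindowExactness`
VERBATIM.  Clause (2) is §2; clause (1): GAP♯∘ at §2's minimiser `U₀ ∈ argminHist V` bounds `wilsonAction4 U − minActionRegPr` below by
`μ·L^{−2(K−J)}·⨅_w Σ dist1² ≥ 0`.  Thresholds: `c₀ := min`, `pS := max`, `ε₁ := min`, `γ₁ := min`. [cite: Balaban1985Variational, Thm 1 (8)-(10) p.279 and (142) p.299] -/
theorem windowExactness_of_gapOrbit_thm1
    (hGap : ∀ (L : ℕ), ∃ c₀ : ℝ, 0 < c₀ ∧ c₀ ≤ 1 ∧ ∀ (cw : ℝ), 0 < cw → cw ≤ c₀ → ∃ pS : ℝ, ∀ (b₀ p₀ : ℝ), 0 < b₀ → pS ≤ p₀ → 0 < p₀ →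
      ∃ ε₁ : ℝ, 0 < ε₁ ∧ ∀ (ε₀ : ℝ), 0 < ε₀ → ε₀ ≤ ε₁ →
      ∃ γ₁ : ℝ, 0 < γ₁ ∧ ∃ μ : ℝ, 0 < μ ∧ ∀ (F : T3Family) (γ : ℝ), F.L = L → 0 < γ → γ ≤ γ₁ →
        ∀ (J K : ℕ) (hJK : J ≤ K) (V : GaugeField (F.P J) 0 (Matrix.specialUnitaryGroup (Fin 2) ℂ)), PlaqSmall (θBal F.L γ (cw * b₀) p₀ J) V →
          ∀ U₀ ∈ {U' | U' ∈ fibre F ℰp J K hJK V ∧ U' ∈ histGood F ℰp (θBal F.L γ b₀ p₀) K J ∧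
              wilsonAction4 U' = minActionRegPr F J K hJK ε₀ V},
            ∀ U ∈ fibre F ℰp J K hJK V, U ∈ histGood F ℰp (θBal F.L γ b₀ p₀) K J →
              μ * ((F.L : ℝ)⁻¹) ^ (2 * (K - J)) *
                  (⨅ w : {w : Site (F.P K) 0 → Matrix.specialUnitaryGroup (Fin 2) ℂ |
                      ∀ U : GaugeField (F.P K) 0 (Matrix.specialUnitaryGroup (Fin 2) ℂ),
                        descendTo F ℰp J K hJK (GaugeField.gaugeAct w U) = descendTo F ℰp J K hJK U},
                    ∑ ℓ : PBond (F.P K) 0,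
                      dist1 (U ℓ * ((GaugeField.gaugeAct (w : Site (F.P K) 0 → Matrix.specialUnitaryGroup (Fin 2) ℂ) U₀) ℓ)⁻¹) ^ 2)
                ≤ wilsonAction4 U - minActionRegPr F J K hJK ε₀ V)
    (hT : ∀ L : ℕ, Odd L → 1 < L → ∃ a₀ a₁ B₃ : ℝ, 0 < a₀ ∧ 0 < a₁ ∧ 0 < B₃ ∧ Thm1GlobalMinAt L a₀ a₁ B₃) :
    ∀ (L : ℕ), ∃ c₀ : ℝ, 0 < c₀ ∧ c₀ ≤ 1 ∧ ∀ (cw : ℝ), 0 < cw → cw ≤ c₀ → ∃ pS : ℝ, ∀ (b₀ p₀ : ℝ), 0 < b₀ → pS ≤ p₀ → 0 < p₀ → ∃ ε₁ : ℝ, 0 < ε₁ ∧ ∀ (ε₀ : ℝ), 0 < ε₀ → ε₀ ≤ ε₁ →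
    ∃ γ₁ : ℝ, 0 < γ₁ ∧ ∀ (F : T3Family) (γ : ℝ), F.L = L → 0 < γ → γ ≤ γ₁ →
      ∀ (J K : ℕ) (hJK : J ≤ K) (V : GaugeField (F.P J) 0 (Matrix.specialUnitaryGroup (Fin 2) ℂ)), PlaqSmall (θBal F.L γ (cw * b₀) p₀ J) V →
        (∀ U ∈ fibre F ℰp J K hJK V, U ∈ histGood F ℰp (θBal F.L γ b₀ p₀) K J →
            minActionRegPr F J K hJK ε₀ V ≤ wilsonAction4 U) ∧
        (∃ U₀ ∈ regFibrePr F J K hJK ε₀ V, U₀ ∈ histGood F ℰp (θBal F.L γ b₀ p₀) K J ∧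
            wilsonAction4 U₀ = minActionRegPr F J K hJK ε₀ V) := by
  have hEx := windowExactnessExists_of_thm1 hT
  intro L
  obtain ⟨c₁, hc₁, hc₁1, h₁⟩ := hEx L
  obtain ⟨c₂, hc₂, -, h₂⟩ := hGap L
  refine ⟨min c₁ c₂, lt_min hc₁ hc₂, (min_le_left _ _).trans hc₁1, fun cw hcw0 hcwle => ?_⟩
  obtain ⟨pS₁, h₁'⟩ := h₁ cw hcw0 (hcwle.trans (min_le_left _ _))
  obtain ⟨pS₂, h₂'⟩ := h₂ cw hcw0 (hcwle.trans (min_le_right _ _))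
  refine ⟨max pS₁ pS₂, fun b₀ p₀ hb hpS hp => ?_⟩
  obtain ⟨ε₁, hε₁, h₁''⟩ := h₁' b₀ p₀ hb ((le_max_left _ _).trans hpS) hp
  obtain ⟨ε₂, hε₂, h₂''⟩ := h₂' b₀ p₀ hb ((le_max_right _ _).trans hpS) hp
  refine ⟨min ε₁ ε₂, lt_min hε₁ hε₂, fun ε₀ hε₀ hε₀le => ?_⟩
  obtain ⟨γ₁, hγ₁, H₁⟩ := h₁'' ε₀ hε₀ (hε₀le.trans (min_le_left _ _))
  obtain ⟨γ₂, hγ₂, μ, hμ, H₂⟩ := h₂'' ε₀ hε₀ (hε₀le.trans (min_le_right _ _))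
  refine ⟨min γ₁ γ₂, lt_min hγ₁ hγ₂, fun F γ hFL hγ hγle J K hJK V hV => ?_⟩
  obtain ⟨U₀, hU₀reg, hU₀good, hU₀min⟩ := H₁ F γ hFL hγ (hγle.trans (min_le_left _ _)) J K hJK V hV
  refine ⟨fun U hU hUg => ?_, U₀, hU₀reg, hU₀good, hU₀min⟩
  have hU₀arg : U₀ ∈ {U' | U' ∈ fibre F ℰp J K hJK V ∧ U' ∈ histGood F ℰp (θBal F.L γ b₀ p₀) K J ∧
      wilsonAction4 U' = minActionRegPr F J K hJK ε₀ V} :=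
    ⟨((mem_regFibrePr_iff F).mp hU₀reg).1, hU₀good, hU₀min⟩
  have hmain := H₂ F γ hFL hγ (hγle.trans (min_le_right _ _)) J K hJK V hV U₀ hU₀arg U hU hUg
  have hLpos : (0 : ℝ) < (F.L : ℝ) := Nat.cast_pos.mpr (lt_trans zero_lt_one F.hL.2)
  have hnn : 0 ≤ μ * ((F.L : ℝ)⁻¹) ^ (2 * (K - J)) *
      (⨅ w : {w : Site (F.P K) 0 → Matrix.specialUnitaryGroup (Fin 2) ℂ |
          ∀ U : GaugeField (F.P K) 0 (Matrix.specialUnitaryGroup (Fin 2) ℂ),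
            descendTo F ℰp J K hJK (GaugeField.gaugeAct w U) = descendTo F ℰp J K hJK U},
        ∑ ℓ : PBond (F.P K) 0,
          dist1 (U ℓ * ((GaugeField.gaugeAct (w : Site (F.P K) 0 → Matrix.specialUnitaryGroup (Fin 2) ℂ) U₀) ℓ)⁻¹) ^ 2) :=
    mul_nonneg (mul_pos hμ (pow_pos (inv_pos.mpr hLpos) _)).le
      (Real.iInf_nonneg fun w => Finset.sum_nonneg fun ℓ _ => sq_nonneg _)
  linarith

/-- ★★★ **THE SAME FROM THE EX LETTER `hT8` VERBATIM** (the 19936 registry's ∕ the persistence leaf's binder 06df69a4: [Balaban1985Variational] Thm 1 (8) ∧ Prop 8 at every odd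
block size; the `MinimisersIn8At` conjunct is not used). [cite: Balaban1985Variational, Thm 1 (8) p.279 and Prop 8 p.304] -/
theorem windowExactness_of_gapOrbit_thm1In8
    (hGap : ∀ (L : ℕ), ∃ c₀ : ℝ, 0 < c₀ ∧ c₀ ≤ 1 ∧ ∀ (cw : ℝ), 0 < cw → cw ≤ c₀ → ∃ pS : ℝ, ∀ (b₀ p₀ : ℝ), 0 < b₀ → pS ≤ p₀ → 0 < p₀ →
      ∃ ε₁ : ℝ, 0 < ε₁ ∧ ∀ (ε₀ : ℝ), 0 < ε₀ → ε₀ ≤ ε₁ →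
      ∃ γ₁ : ℝ, 0 < γ₁ ∧ ∃ μ : ℝ, 0 < μ ∧ ∀ (F : T3Family) (γ : ℝ), F.L = L → 0 < γ → γ ≤ γ₁ →
        ∀ (J K : ℕ) (hJK : J ≤ K) (V : GaugeField (F.P J) 0 (Matrix.specialUnitaryGroup (Fin 2) ℂ)), PlaqSmall (θBal F.L γ (cw * b₀) p₀ J) V →
          ∀ U₀ ∈ {U' | U' ∈ fibre F ℰp J K hJK V ∧ U' ∈ histGood F ℰp (θBal F.L γ b₀ p₀) K J ∧
              wilsonAction4 U' = minActionRegPr F J K hJK ε₀ V},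
            ∀ U ∈ fibre F ℰp J K hJK V, U ∈ histGood F ℰp (θBal F.L γ b₀ p₀) K J →
              μ * ((F.L : ℝ)⁻¹) ^ (2 * (K - J)) *
                  (⨅ w : {w : Site (F.P K) 0 → Matrix.specialUnitaryGroup (Fin 2) ℂ |
                      ∀ U : GaugeField (F.P K) 0 (Matrix.specialUnitaryGroup (Fin 2) ℂ),
                        descendTo F ℰp J K hJK (GaugeField.gaugeAct w U) = descendTo F ℰp J K hJK U},
                    ∑ ℓ : PBond (F.P K) 0,
                      dist1 (U ℓ * ((GaugeField.gaugeAct (w : Site (F.P K) 0 → Matrix.specialUnitaryGroup (Fin 2) ℂ) U₀) ℓ)⁻¹) ^ 2)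
                ≤ wilsonAction4 U - minActionRegPr F J K hJK ε₀ V)
    (hT8 : ∀ L : ℕ, Odd L → 1 < L → ∃ a₀ a₁ B₃ : ℝ, 0 < a₀ ∧ 0 < a₁ ∧ 0 < B₃ ∧
      Thm1GlobalMinAt L a₀ a₁ B₃ ∧ MinimisersIn8At L a₀ a₁ B₃) :
    ∀ (L : ℕ), ∃ c₀ : ℝ, 0 < c₀ ∧ c₀ ≤ 1 ∧ ∀ (cw : ℝ), 0 < cw → cw ≤ c₀ → ∃ pS : ℝ, ∀ (b₀ p₀ : ℝ), 0 < b₀ → pS ≤ p₀ → 0 < p₀ → ∃ ε₁ : ℝ, 0 < ε₁ ∧ ∀ (ε₀ : ℝ), 0 < ε₀ → ε₀ ≤ ε₁ →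
    ∃ γ₁ : ℝ, 0 < γ₁ ∧ ∀ (F : T3Family) (γ : ℝ), F.L = L → 0 < γ → γ ≤ γ₁ →
      ∀ (J K : ℕ) (hJK : J ≤ K) (V : GaugeField (F.P J) 0 (Matrix.specialUnitaryGroup (Fin 2) ℂ)), PlaqSmall (θBal F.L γ (cw * b₀) p₀ J) V →
        (∀ U ∈ fibre F ℰp J K hJK V, U ∈ histGood F ℰp (θBal F.L γ b₀ p₀) K J →
            minActionRegPr F J K hJK ε₀ V ≤ wilsonAction4 U) ∧
        (∃ U₀ ∈ regFibrePr F J K hJK ε₀ V, U₀ ∈ histGood F ℰp (θBal F.L γ b₀ p₀) K J ∧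
            wilsonAction4 U₀ = minActionRegPr F J K hJK ε₀ V) :=
  windowExactness_of_gapOrbit_thm1 hGap fun L hLo hL1 => by
    obtain ⟨a₀, a₁, B₃, ha₀, ha₁, hB₃, hT1, -⟩ := hT8 L hLo hL1
    exact ⟨a₀, a₁, B₃, ha₀, ha₁, hB₃, hT1⟩

end Door

end Summit.QuantumFields.YangMills.Theorems.FluctuationComparisonRegPrIntLWindowExactnessOfGapOrbitThm1

end
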